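import Literature.MathematicalPhysics.QuantumFieldTheory.O2DimBox
import Literature.MathematicalPhysics.QuantumFieldTheory.O2ChargedSectorsRules
import HarnessLib

/-!
# O(2) `{φ, s, t}` scan: bound cells of sectors `3`, `2⁻`, `4` on a box of external dimensions

The `spinning_3`, `spinning_2m`, `spinning_4` rows of `O2ScanObligations.O2Obligations` start AT the
unitarity bound (`Δ ≥ ℓ + 1`, `ℓ ≥ 1`).  The tree proves them at ONE triple `D` of external dimensions
from corner tables INLINED at `D` (`O2ChargedSectorsRules.pos3_on_boundCell_Ico_of_corners`,
`pos2m_on_boundCell_Ico_of_corners`, `O2ChargeFourRules.pos4_on_boundCell_Ico_of_corners`).  This file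

1. states the three bound-cell rules TABLE-PARAMETRICALLY at one `D` (`pos3_on_boundCell_Ico`,
   `pos2m_on_boundCell_Ico`, `pos4_on_boundCell_Ico`): any number table `Φlo` valid from below on the cell
   (`Φlo_q ≤ T(Δ + n, j)` for `Δ ∈ [a, b]`) with `oddHeadCellSumBd … Φlo ≥ 0` / `headCellSumM … Φlo ≥ 0`
   and nonnegative tails gives the row on `[a, b)` — the same argument as the tree's `_of_corners` rules
   with the table abstracted;
2. derives the rules UNIFORMLY ON A BOX `lo ≤ D ≤ hi` of external dimensions (`O2DimBox.InDimBox`):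
   `pos3_on_dbox_boundCell`, `pos2m_on_dbox_boundCell`, `pos4_on_dbox_boundCell` — the corner tables at
   the box exponent interval `[lo.expo L, hi.expo L]` (`O2DimBox.twoWeightEval_mem_Icc_corner_expo`) are
   valid at every `D` of the box, and the block-parameter interval `[c₁, c₂]` is taken to contain the
   box's range of `(Δ_t − Δ_φ)/2` (sector `3`) / `(Δ_t − Δ_s)/2` (sector `2⁻`).

With `O2LightDimBox` (generic cells and the neutral bound cells) this makes EVERY light row of the seven
sectors `D`-uniform.  NON-CLAIMS: sufficient conditions only; no number is evaluated; nothing is asserted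
about the O(2) model.  RECORD of the engines lane (PLANNING ONLY for the `O(2)` client path).
-/

noncomputable section

namespace Literature.MathematicalPhysics.QuantumFieldTheory.O2BoundCellsDimBox

open Set Finset Filter Topology
open Literature.MathematicalPhysics.QuantumFieldTheory.ConformalBootstrap3D
open O2ThreeScalarCrossing O2ThreeScalarSystem O2OPEScanBridge O2ScanObligations
open O2NeutralSectorsTermwise O2NeutralSectorsTail O2NeutralSectorsBoundCells O2ChargedSectorsTermwise
open O2ChargedSectorsRules O2ChargeFourRules O2DimBox

/-! ## 1. Table-parametric bound-cell rules at one `D` -/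

/-- **Sector-`3` BOUND-CELL RULE, table-parametric** (`ℓ ≥ 1`, cell `[a, b)` with `a ≥ ℓ + 1`): a table
`Φlo` valid from below for the kernel terms on the cell, `oddHeadCellSumBd ℓ c₁ c₂ a b S Φlo ≥ 0` with
`[c₁, c₂] ∋ (Δ_t − Δ_φ)/2`, and nonnegative tails give `Pos3` on `[a, b)`.
[cite: DolanOsborn2004, §3 eq. (3.11)] [cite: KosPolandSimmonsduffin2014, §3.3 eq. (3.16), §4 eqs. (4.2)–(4.3)]
[cite: HogervorstRychkov2013, §3 eq. (3.6)] -/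
theorem pos3_on_boundCell_Ico (F : ScanFunctional) (D : Dims) {ℓ : ℕ} {a b c₁ c₂ : ℝ} (hℓ : 1 ≤ ℓ)
    (ha : (ℓ : ℝ) + 1 ≤ a) (hc1 : c₁ ≤ (D.Δt - D.Δφ) / 2) (hc2 : (D.Δt - D.Δφ) / 2 ≤ c₂)
    (S : Finset (ℕ × ℕ)) (Φlo : ℕ × ℕ → ℝ)
    (hΦ : ∀ q ∈ S, ∀ Δ ∈ Icc a b, Φlo q ≤ dom3Term F D (Δ + (q.1 : ℝ)) q.2)
    (hX : 0 ≤ oddHeadCellSumBd ℓ c₁ c₂ a b S Φlo)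
    (htail : ∀ q : ℕ × ℕ, q ∉ S → InDescendantRange ℓ q.1 q.2 →
      ∀ E ∈ Icc (a + q.1) (b + q.1), 0 ≤ dom3Term F D E q.2) :
    ∀ Δ ∈ Ico a b, Pos3 F.toFunctional D Δ ℓ := by
  have hcell : ∀ Δ' ∈ Icc a b, IsRegularPoint3D Δ' ℓ → ∀ G : Label → ℝ → ℝ → ℝ,
      IsConformalBlock3D (D.Δt - D.Δφ) (D.Δt - D.Δφ) Δ' ℓ (G .tφtφ) →
      IsConformalBlock3D (-(D.Δt - D.Δφ)) (D.Δt - D.Δφ) Δ' ℓ (G .φttφ) →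
      0 ≤ sector3Value F D ((-1) ^ ℓ) G := by
    intro Δ' hΔI hreg G hG₁ hG₂
    have hbd : unitarityBound3D ℓ ≤ Δ' := ((unitarityBound3D_le_add_one ℓ).trans ha).trans hΔI.1
    have hlt : unitarityBound3D ℓ < Δ' := lt_of_le_of_ne hbd (Ne.symm hreg.1)
    have hx : (ℓ : ℝ) + 1 < Δ' := by rw [← unitarityBound3D_of_one_le hℓ]; exact hlt
    have hl0 : ℓ = 0 → Δ' ≠ 1 := fun h => absurd h (by omega)
    exact (dom3Eval_nonneg_of_termwise F D hlt hreg.2 S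
        (headSumAB_nonneg_of_cellSumBd (dom3Term F D) hℓ ha hΔI hx hc1 hc2 S Φlo
          (fun q hq => hΦ q hq Δ' hΔI) hX)
        (fun q hq hr => htail q hq hr (Δ' + (q.1 : ℝ)) ⟨by linarith [hΔI.1], by linarith [hΔI.2]⟩)
        hG₂).trans
      (dom3Eval_le_sector3Value F D (abs_neg_one_pow_le_one ℓ) hlt hreg.2 hl0 hG₁ hG₂)
  intro Δ hΔ
  by_cases hr : IsRegularPoint3D Δ ℓ
  · exact pos3_of_forall_sector3Value_nonneg F D fun G hG₁ hG₂ => hcell Δ ⟨hΔ.1, hΔ.2.le⟩ hr G hG₁ hG₂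
  · have hbd : unitarityBound3D ℓ ≤ Δ := ((unitarityBound3D_le_add_one ℓ).trans ha).trans hΔ.1
    refine pos3_of_eventually_right F D hr ?_
    filter_upwards [eventually_isRegularPoint3D_nhdsGT_of_bound_le hbd, Ioo_mem_nhdsGT hΔ.2]
      with Δ' hΔ'reg hΔ'
    exact ⟨hΔ'reg, fun G hG₁ hG₂ => hcell Δ' ⟨hΔ.1.trans hΔ'.1.le, hΔ'.2.le⟩ hΔ'reg G hG₁ hG₂⟩

/-- **Sector-`2⁻` BOUND-CELL RULE, table-parametric** (`ℓ ≥ 1`, `a ≥ ℓ + 1`, `[c₁, c₂] ∋ (Δ_t − Δ_s)/2`).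
[cite: DolanOsborn2004, §3 eq. (3.11)] [cite: KosPolandSimmonsduffin2014, §3.3 eq. (3.16), §4 eqs. (4.2)–(4.3)]
[cite: HogervorstRychkov2013, §3 eq. (3.6)] -/
theorem pos2m_on_boundCell_Ico (F : ScanFunctional) (D : Dims) {ℓ : ℕ} {a b c₁ c₂ : ℝ} (hℓ : 1 ≤ ℓ)
    (ha : (ℓ : ℝ) + 1 ≤ a) (hc1 : c₁ ≤ (D.Δt - D.Δs) / 2) (hc2 : (D.Δt - D.Δs) / 2 ≤ c₂)
    (S : Finset (ℕ × ℕ)) (Φlo : ℕ × ℕ → ℝ)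
    (hΦ : ∀ q ∈ S, ∀ Δ ∈ Icc a b, Φlo q ≤ dom2mTerm F D (Δ + (q.1 : ℝ)) q.2)
    (hX : 0 ≤ oddHeadCellSumBd ℓ c₁ c₂ a b S Φlo)
    (htail : ∀ q : ℕ × ℕ, q ∉ S → InDescendantRange ℓ q.1 q.2 →
      ∀ E ∈ Icc (a + q.1) (b + q.1), 0 ≤ dom2mTerm F D E q.2) :
    ∀ Δ ∈ Ico a b, Pos2m F.toFunctional D Δ ℓ := by
  have hcell : ∀ Δ' ∈ Icc a b, IsRegularPoint3D Δ' ℓ → ∀ G : Label → ℝ → ℝ → ℝ,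
      IsConformalBlock3D (D.Δt - D.Δs) (D.Δt - D.Δs) Δ' ℓ (G .tsts) →
      IsConformalBlock3D (-(D.Δt - D.Δs)) (D.Δt - D.Δs) Δ' ℓ (G .stts) →
      0 ≤ sector2mValue F D G := by
    intro Δ' hΔI hreg G hG₁ hG₂
    have hbd : unitarityBound3D ℓ ≤ Δ' := ((unitarityBound3D_le_add_one ℓ).trans ha).trans hΔI.1
    have hlt : unitarityBound3D ℓ < Δ' := lt_of_le_of_ne hbd (Ne.symm hreg.1)
    have hx : (ℓ : ℝ) + 1 < Δ' := by rw [← unitarityBound3D_of_one_le hℓ]; exact hlt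
    have hl0 : ℓ = 0 → Δ' ≠ 1 := fun h => absurd h (by omega)
    exact (dom2mEval_nonneg_of_termwise F D hlt hreg.2 S
        (headSumAB_nonneg_of_cellSumBd (dom2mTerm F D) hℓ ha hΔI hx hc1 hc2 S Φlo
          (fun q hq => hΦ q hq Δ' hΔI) hX)
        (fun q hq hr => htail q hq hr (Δ' + (q.1 : ℝ)) ⟨by linarith [hΔI.1], by linarith [hΔI.2]⟩)
        hG₂).trans
      (dom2mEval_le_sector2mValue F D hlt hreg.2 hl0 hG₁ hG₂)
  intro Δ hΔ
  by_cases hr : IsRegularPoint3D Δ ℓ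
  · exact pos2m_of_forall_sector2mValue_nonneg F D fun G hG₁ hG₂ =>
      hcell Δ ⟨hΔ.1, hΔ.2.le⟩ hr G hG₁ hG₂
  · have hbd : unitarityBound3D ℓ ≤ Δ := ((unitarityBound3D_le_add_one ℓ).trans ha).trans hΔ.1
    refine pos2m_of_eventually_right F D hr ?_
    filter_upwards [eventually_isRegularPoint3D_nhdsGT_of_bound_le hbd, Ioo_mem_nhdsGT hΔ.2]
      with Δ' hΔ'reg hΔ'
    exact ⟨hΔ'reg, fun G hG₁ hG₂ => hcell Δ' ⟨hΔ.1.trans hΔ'.1.le, hΔ'.2.le⟩ hΔ'reg G hG₁ hG₂⟩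

/-- **Sector-`4` BOUND-CELL RULE, table-parametric** (cell `[a, b)` with `a ≥ ℓ + 1`, the monotone
`hrCoeff` sandwich of `headCellSumM`). [cite: DolanOsborn2004, §3 eq. (3.11)]
[cite: KosPolandSimmonsduffin2014, §3.3 eq. (3.16), §4 eqs. (4.2)–(4.3)] [cite: HogervorstRychkov2013, §3 eqs. (3.6), (3.9)] -/
theorem pos4_on_boundCell_Ico (F : ScanFunctional) (D : Dims) {ℓ : ℕ} {a b : ℝ} (ha : (ℓ : ℝ) + 1 ≤ a)
    (S : Finset (ℕ × ℕ)) (Φlo : ℕ × ℕ → ℝ)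
    (hΦ : ∀ q ∈ S, ∀ Δ ∈ Icc a b, Φlo q ≤ sector4Term F D (Δ + (q.1 : ℝ)) q.2)
    (hX : 0 ≤ headCellSumM ℓ a b S Φlo)
    (htail : ∀ q : ℕ × ℕ, q ∉ S → InDescendantRange ℓ q.1 q.2 →
      ∀ E ∈ Icc (a + q.1) (b + q.1), 0 ≤ sector4Term F D E q.2) :
    ∀ Δ ∈ Ico a b, Pos4 F.toFunctional D Δ ℓ := by
  have hval : ∀ Δ' ∈ Icc a b, IsRegularPoint3D Δ' ℓ → ∀ G : Label → ℝ → ℝ → ℝ,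
      (∀ L ∈ labels4, IsConformalBlock3D 0 0 Δ' ℓ (G L)) → 0 ≤ sector4Value F D G := by
    intro Δ' hΔI hreg G hG
    have hlt : unitarityBound3D ℓ < Δ' :=
      lt_of_le_of_ne (((unitarityBound3D_le_add_one ℓ).trans ha).trans hΔI.1) (Ne.symm hreg.1)
    refine sector4Value_nonneg_of_termwise F D hlt hreg.2 S ?_
      (fun q hq hr' => htail q hq hr' (Δ' + (q.1 : ℝ)) ⟨by linarith [hΔI.1], by linarith [hΔI.2]⟩) hG
    have hsum : headCellSumM ℓ a b S Φlo ≤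
        ∑ q ∈ S, hrCoeff Δ' ℓ q.1 q.2 * sector4Term F D (Δ' + (q.1 : ℝ)) q.2 := by
      refine Finset.sum_le_sum fun q hq => ?_
      have hA := hrCoeff_monotone_sandwich ha hΔI.1 hΔI.2 q.1 q.2
      exact min_mul_le_mul_of_bounds hA.2.1 hA.2.2 (hA.1.trans hA.2.1) (hΦ q hq Δ' hΔI)
    have heq : ∑ q ∈ S, hrCoeff Δ' ℓ q.1 q.2 / legendreLam ℓ * sector4Term F D (Δ' + (q.1 : ℝ)) q.2 =
        (legendreLam ℓ)⁻¹ * ∑ q ∈ S, hrCoeff Δ' ℓ q.1 q.2 * sector4Term F D (Δ' + (q.1 : ℝ)) q.2 := by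
      rw [Finset.mul_sum]
      exact Finset.sum_congr rfl fun q _ => by rw [div_eq_inv_mul]; ring
    rw [heq]
    exact mul_nonneg (inv_nonneg.mpr (legendreLam_pos ℓ).le) (hX.trans hsum)
  intro Δ hΔ
  by_cases hr : IsRegularPoint3D Δ ℓ
  · exact pos4_of_forall_sector4Value_nonneg F D fun G hG => hval Δ ⟨hΔ.1, hΔ.2.le⟩ hr G hG
  · have hbd : unitarityBound3D ℓ ≤ Δ := ((unitarityBound3D_le_add_one ℓ).trans ha).trans hΔ.1
    refine pos4_of_eventually_right F D hr ?_
    filter_upwards [eventually_isRegularPoint3D_nhdsGT_of_bound_le hbd, Ioo_mem_nhdsGT hΔ.2]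
      with Δ' hΔ'reg hΔ'
    exact ⟨hΔ'reg, fun G hG => hval Δ' ⟨hΔ.1.trans hΔ'.1.le, hΔ'.2.le⟩ hΔ'reg G hG⟩

/-! ## 2. Bound cells uniformly on a box of external dimensions -/

/-- **SECTOR-`3` BOUND CELLS ON A BOX OF EXTERNAL DIMENSIONS**: the corner table at the box exponent
interval `[lo.expo φttφ, hi.expo φttφ]` and a parameter interval `[c₁, c₂] ⊇` the box's range of
`(Δ_t − Δ_φ)/2` give the `spinning_3` row on `[a, b)` at EVERY `D` of the box.
[cite: KosPolandSimmonsduffin2014, §3.3 eq. (3.16), §4 eqs. (4.2)–(4.3)] [cite: DolanOsborn2004, §3 eq. (3.11)]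
[cite: ChesterEtAl2020, §3.3 (scanning over external dimensions)] -/
theorem pos3_on_dbox_boundCell (F : ScanFunctional) {lo hi : Dims} {ℓ : ℕ} {a b c₁ c₂ : ℝ} (hℓ : 1 ≤ ℓ)
    (ha : (ℓ : ℝ) + 1 ≤ a) (hc1 : c₁ ≤ (lo.Δt - hi.Δφ) / 2) (hc2 : (hi.Δt - lo.Δφ) / 2 ≤ c₂)
    (S : Finset (ℕ × ℕ))
    (hX : 0 ≤ oddHeadCellSumBd ℓ c₁ c₂ a b S (fun q => cornerBound₂ (cWeight3 F) (dWeight3 F) F.z F.zb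
      q.2 (a + q.1) (b + q.1) (lo.expo .φttφ) (hi.expo .φttφ)))
    (htail : ∀ D, InDimBox lo hi D → ∀ q : ℕ × ℕ, q ∉ S → InDescendantRange ℓ q.1 q.2 →
      ∀ E ∈ Icc (a + q.1) (b + q.1), 0 ≤ dom3Term F D E q.2) :
    ∀ D, InDimBox lo hi D → ∀ Δ ∈ Ico a b, Pos3 F.toFunctional D Δ ℓ := by
  intro D hD
  have hD' := hD
  obtain ⟨-, ⟨hp1, hp2⟩, ⟨ht1, ht2⟩⟩ := hD'
  exact pos3_on_boundCell_Ico F D hℓ ha (by linarith) (by linarith) S _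
    (fun q _ Δ hΔ => by
      rw [dom3Term_eq_twTerm]
      exact (twoWeightEval_mem_Icc_corner_expo F (cWeight3 F) (dWeight3 F) q.2
        (E := Δ + (q.1 : ℝ)) ⟨by linarith [hΔ.1], by linarith [hΔ.2]⟩ hD .φttφ).1)
    hX (htail D hD)

/-- **SECTOR-`2⁻` BOUND CELLS ON A BOX OF EXTERNAL DIMENSIONS** (block parameter `(Δ_t − Δ_s)/2`,
corner table at `[lo.expo stts, hi.expo stts]`).
[cite: KosPolandSimmonsduffin2014, §3.3 eq. (3.16), §4 eqs. (4.2)–(4.3)] [cite: DolanOsborn2004, §3 eq. (3.11)]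
[cite: ChesterEtAl2020, §3.3 (scanning over external dimensions)] -/
theorem pos2m_on_dbox_boundCell (F : ScanFunctional) {lo hi : Dims} {ℓ : ℕ} {a b c₁ c₂ : ℝ}
    (hℓ : 1 ≤ ℓ) (ha : (ℓ : ℝ) + 1 ≤ a) (hc1 : c₁ ≤ (lo.Δt - hi.Δs) / 2)
    (hc2 : (hi.Δt - lo.Δs) / 2 ≤ c₂) (S : Finset (ℕ × ℕ))
    (hX : 0 ≤ oddHeadCellSumBd ℓ c₁ c₂ a b S (fun q => cornerBound₂ (cWeight2m F) (dWeight2m F) F.z F.zb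
      q.2 (a + q.1) (b + q.1) (lo.expo .stts) (hi.expo .stts)))
    (htail : ∀ D, InDimBox lo hi D → ∀ q : ℕ × ℕ, q ∉ S → InDescendantRange ℓ q.1 q.2 →
      ∀ E ∈ Icc (a + q.1) (b + q.1), 0 ≤ dom2mTerm F D E q.2) :
    ∀ D, InDimBox lo hi D → ∀ Δ ∈ Ico a b, Pos2m F.toFunctional D Δ ℓ := by
  intro D hD
  have hD' := hD
  obtain ⟨⟨hs1, hs2⟩, -, ⟨ht1, ht2⟩⟩ := hD'
  exact pos2m_on_boundCell_Ico F D hℓ ha (by linarith) (by linarith) S _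
    (fun q _ Δ hΔ => by
      rw [dom2mTerm_eq_twTerm]
      exact (twoWeightEval_mem_Icc_corner_expo F (cWeight2m F) (dWeight2m F) q.2
        (E := Δ + (q.1 : ℝ)) ⟨by linarith [hΔ.1], by linarith [hΔ.2]⟩ hD .stts).1)
    hX (htail D hD)

/-- **SECTOR-`4` BOUND CELLS ON A BOX OF EXTERNAL DIMENSIONS** (corner table at
`[lo.expo tttt, hi.expo tttt]`). [cite: KosPolandSimmonsduffin2014, §3.3 eq. (3.16), §4 eqs. (4.2)–(4.3)]
[cite: DolanOsborn2004, §3 eq. (3.11)] [cite: ChesterEtAl2020, §3.3 (scanning over external dimensions)] -/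
theorem pos4_on_dbox_boundCell (F : ScanFunctional) {lo hi : Dims} {ℓ : ℕ} {a b : ℝ}
    (ha : (ℓ : ℝ) + 1 ≤ a) (S : Finset (ℕ × ℕ))
    (hX : 0 ≤ headCellSumM ℓ a b S (fun q => cornerBound₂ (cWeight4 F) (dWeight4 F) F.z F.zb q.2
      (a + q.1) (b + q.1) (lo.expo .tttt) (hi.expo .tttt)))
    (htail : ∀ D, InDimBox lo hi D → ∀ q : ℕ × ℕ, q ∉ S → InDescendantRange ℓ q.1 q.2 →
      ∀ E ∈ Icc (a + q.1) (b + q.1), 0 ≤ sector4Term F D E q.2) :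
    ∀ D, InDimBox lo hi D → ∀ Δ ∈ Ico a b, Pos4 F.toFunctional D Δ ℓ := fun D hD =>
  pos4_on_boundCell_Ico F D ha S _
    (fun q _ Δ hΔ => by
      rw [sector4Term_eq_twoWeightEval]
      exact (twoWeightEval_mem_Icc_corner_expo F (cWeight4 F) (dWeight4 F) q.2
        (E := Δ + (q.1 : ℝ)) ⟨by linarith [hΔ.1], by linarith [hΔ.2]⟩ hD .tttt).1)
    hX (htail D hD)

end Literature.MathematicalPhysics.QuantumFieldTheory.O2BoundCellsDimBox

end
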